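/-
B2b (LevelGradedCohnUmans, decidable (m,k) = (2,1) cell) — gen 17.
**The dischargeable form of the `p = 31` residual.**

VALUE = THEOREM / DECIDABLE VERDICT on one cell, NOT summit progress; the crux item
`SubgroupIdentityDesigns` is untouched and remains open.
Report: `run/shared/lean/b2b/levelgraded-cu/ORACLE-g17.md` §G17-3, §G17-5 (S-g).
-/
import Mathlib
import Summits.MatrixMultiplication.MatrixMultiplication.Theorems.SubgroupIdentityDesigns.Negative.CellTwoOneVerdict

/-!
# The residual in dischargeable form

`CellTwoOneVerdict.cellTwoOne_empty_of_no_residual` packages the `(2,1)` verdict over the TPP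
alone; but residual-profile triples WITH the TPP exist at `p = 31` (DATA: gen-16 `proj_tpp.py 31`
and the census `j126482`, 45 720 subgroup-TPP triples), so that hypothesis cannot be discharged.
What the census actually establishes (as DATA: every ordering certificate-killed via
`OrbitCertificate.no_levelOne_design_of_orbit_certificate`-type certificates) is the DESIGN
statement: no residual-profile TPP triple carries a rank-`≤ 1` identity design in its TPP order.
**`cellTwoOne_empty_of_no_residual_design`** records that this statement — and nothing more —
empties the `(2,1)` cell at every prime for `0 < ε ≤ 1`.  Proving its hypothesis in Lean at
`p = 31` is the one remaining non-theorem point of the cell.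
-/

set_option linter.dupNamespace false

noncomputable section

open scoped Classical
open Summit.MatrixMultiplication.MatrixMultiplication.Theorems.LieRankDesigns.Negative (GLm Mat budget)
open Literature.Barriers.MatrixMultiplication (SubgroupTPP)

namespace Summit.MatrixMultiplication.MatrixMultiplication.Theorems.SubgroupIdentityDesigns.Negative

section ResidualDesign

variable {p : ℕ} [hp : Fact p.Prime]

/-- **The dischargeable residual statement.**  If every residual-profile triple `(E, A, B)` at `p`
(`-1 ∈ E`, `|E| = 120`, image `60`, `E` conjugate into no Cartan normaliser; `A`, `B` conjugate
into the monomial group with `(|A|, |S_A|; |B|, |S_B|) = (90, 3; 150, 5)`) that has the TPP in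
some order carries NO rank-`≤ 1` identity design in that order, then the `(2,1)` cell is empty at
every prime (`0 < ε ≤ 1`).  This is exactly what the gen-16 exhaustive census establishes at
`p = 31` as DATA (every ordering of all 45 720 TPP triples certificate-killed); proving `hres` in
Lean is the one remaining non-theorem point of the cell.  NOT summit progress. -/
theorem cellTwoOne_empty_of_no_residual_design
    (hres : ∀ (E A B : Subgroup (GLm p 2)), scalarHom p 2 (-1) ∈ E → Nat.card E = 120 →
      Nat.card (E.map (QuotientGroup.mk' (scalarHom p 2).range)) = 60 →
      (∀ g : GLm p 2, ∃ x ∈ E, ¬ IsMonomial (g * x * g⁻¹)) →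
      (∀ n : ZMod p, (∀ x : ZMod p, x * x ≠ n) →
        ∀ g : GLm p 2, ∃ x ∈ E, ¬ IsSingerNormal n (g * x * g⁻¹)) →
      (∃ g : GLm p 2, ∀ x ∈ A, IsMonomial (g * x * g⁻¹)) →
      (∃ g : GLm p 2, ∀ x ∈ B, IsMonomial (g * x * g⁻¹)) →
      Nat.card A = 90 → Nat.card (A.comap (scalarHom p 2)) = 3 →
      Nat.card B = 150 → Nat.card (B.comap (scalarHom p 2)) = 5 →
      ∀ (K₁ K₂ K₃ : Subgroup (GLm p 2)),
        ((K₁ = E ∧ K₂ = A ∧ K₃ = B) ∨ (K₁ = A ∧ K₂ = E ∧ K₃ = B) ∨ (K₁ = A ∧ K₂ = B ∧ K₃ = E) ∨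
          (K₁ = E ∧ K₂ = B ∧ K₃ = A) ∨ (K₁ = B ∧ K₂ = E ∧ K₃ = A) ∨ (K₁ = B ∧ K₂ = A ∧ K₃ = E)) →
        SubgroupTPP K₁ K₂ K₃ →
        ¬ ∃ c : Mat p 2 → ℂ, (∀ M, 1 < M.rank → c M = 0) ∧
          (∑ M, c M * ZMod.stdAddChar (Matrix.trace (M * ((1 : GLm p 2) : Mat p 2)))) = 1 ∧
          ∀ a ∈ K₁, ∀ b ∈ K₂, ∀ g ∈ K₃, a * b * g ≠ 1 →
            (∑ M, c M *
              ZMod.stdAddChar (Matrix.trace (M * ((a * b * g : GLm p 2) : Mat p 2)))) = 0)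
    {ε : ℝ} (hε : 0 < ε) (hε1 : ε ≤ 1)
    {H₁ H₂ H₃ : Subgroup (GLm p 2)} (htpp : SubgroupTPP H₁ H₂ H₃)
    (hdesign : ∃ c : Mat p 2 → ℂ, (∀ M, 1 < M.rank → c M = 0) ∧
      (∑ M, c M * ZMod.stdAddChar (Matrix.trace (M * ((1 : GLm p 2) : Mat p 2)))) = 1 ∧
      ∀ a ∈ H₁, ∀ b ∈ H₂, ∀ g ∈ H₃, a * b * g ≠ 1 →
        (∑ M, c M *
          ZMod.stdAddChar (Matrix.trace (M * ((a * b * g : GLm p 2) : Mat p 2)))) = 0) :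
    ¬ budget p 2 1 (2 + ε) <
      ((Nat.card H₁ * Nat.card H₂ * Nat.card H₃ : ℕ) : ℝ) ^ ((2 + ε) / 3) := by
  intro hwit
  obtain ⟨-, E, A, B, hperm, hmem, hE, himg, hnm, hns, hAm, hBm, hnum⟩ :=
    levelOne_witness_verdict hε hε1 htpp hdesign hwit
  rcases hnum with ⟨hA, hzA, hB, hzB⟩ | ⟨hA, hzA, hB, hzB⟩
  · refine hres E A B hmem hE himg hnm hns hAm hBm hA hzA hB hzB H₁ H₂ H₃ ?_ htpp hdesign
    rcases hperm with ⟨rfl, rfl, rfl⟩ | ⟨rfl, rfl, rfl⟩ | ⟨rfl, rfl, rfl⟩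
    · exact Or.inl ⟨rfl, rfl, rfl⟩
    · exact Or.inr (Or.inl ⟨rfl, rfl, rfl⟩)
    · exact Or.inr (Or.inr (Or.inl ⟨rfl, rfl, rfl⟩))
  · refine hres E B A hmem hE himg hnm hns hBm hAm hB hzB hA hzA H₁ H₂ H₃ ?_ htpp hdesign
    rcases hperm with ⟨rfl, rfl, rfl⟩ | ⟨rfl, rfl, rfl⟩ | ⟨rfl, rfl, rfl⟩
    · exact Or.inr (Or.inr (Or.inr (Or.inl ⟨rfl, rfl, rfl⟩)))
    · exact Or.inr (Or.inr (Or.inr (Or.inr (Or.inl ⟨rfl, rfl, rfl⟩))))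
    · exact Or.inr (Or.inr (Or.inr (Or.inr (Or.inr ⟨rfl, rfl, rfl⟩))))

end ResidualDesign

end Summit.MatrixMultiplication.MatrixMultiplication.Theorems.SubgroupIdentityDesigns.Negative

end
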